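import Literature.Computability.Complexity.AutomaticSequences
import Mathlib.Combinatorics.HalesJewett
import Mathlib.NumberTheory.PrimesCongruentOne
import Mathlib.Data.ZMod.Basic
import Mathlib.Data.Nat.Factorial.Basic
import Mathlib.Data.Fintype.Pigeonhole
import Mathlib.Data.Fintype.Powerset
import Mathlib.Tactic.LinearCombination
import HarnessLib

/-!
# `Ω(n) mod 2` is not `2`-automatic (discharge of `coons_cardFactors_mod_two_not_automatic`)

This file discharges the named fact
`Literature.Computability.Complexity.coons_cardFactors_mod_two_not_automatic` of
`Literature/Computability/Complexity/AutomaticSequences.lean`: the `2`-kernel of `n ↦ Ω(n) mod 2`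
is infinite (M. Coons, *(Non)Automaticity of number theoretic functions*, J. Théor. Nombres
Bordeaux **22** (2010), 339–352, Corollary 1.7 [Coons2011]).

## Proof

Coons's printed proof (loc. cit., §2: Theorem 1.5 for `λ` via the pole count of `ζ(2s)/ζ(s)` —
von Mangoldt's `N(T) ≍ T log T` against the `O(T)` poles of an automatic Dirichlet series,
Allouche–Mendès France–Peyrière — then Lemma 1.6, Corollary 1.7) is analytic and far beyond
Mathlib.  We give instead the elementary combinatorial argument of J.-C. Schlage-Puchta,
*Completely multiplicative automatic functions*, Integers **11** (2011), A31, proof of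
Proposition 1 [Schlagepuchta2011], specialised to the completely additive `t = Ω mod 2` in base
`2`, with its final appeal to the Wirsing–Halász mean-value theorem replaced by an elementary step
special to `Ω` (every prime has `t p = 1`).  With `K` the (finite, by assumption) `2`-kernel:

1. *Colouring* `σ m = (f m mod 2)_{f ∈ K}` (a map into the finite type `K → Fin 2`; the automaton
   reading the most significant digit first).  Equal colours have equal futures,
   `t (2^ℓ m + r) = t (2^ℓ m' + r)` for `r < 2^ℓ` (`futures`), and `σ` is a congruence for
   appending binary digits (`sig_append`).
2. *Reachable colour sets* `R z n = {σ (n 2^z + v) : v < 2^z}` satisfy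
   `R y n = R y' n → R (y+z) n = R (y'+z) n` (`reach_add_eq`); pigeonhole in the finite power set
   gives ONE `B ≥ 1` with `R (yB) n = R B n` for all `n`, `y ≥ 1` (`exists_period`;
   Schlage-Puchta: `B = |S|!`).  `σ` and `R` are proof-local; the lemmas take them as parameters
   together with their defining equations `hσ`, `hR`.
3. *van der Waerden* (Mathlib's `Combinatorics.exists_mono_homothetic_copy`): a `σ`-monochromatic
   progression `a, a+D, …, a+ND`, `N = 2^{B+1}+1`.
4. *Division by `D`* (`ap_of_mono`): with `k = D` (so `2^k > D`), `b < D`, `D ∣ a 2^k + b`, the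
   numbers `(a+jD)2^k + b = D (a₀ + j 2^k)` share their `t`-value, hence so do the `a₀ + j 2^k`
   (`t (D x) = t D + t x mod 2`): a long `t`-constant progression with difference `2^k`.
5. *Alignment* (`align`): it contains a block `{2^k (u 2^B + v) + w : v < 2^B}`, `w < 2^k`.
6. *Pumping* (`pump`): by 1–2, `t (2^k (u 2^{yB} + v) + w) = c` for all `y ≥ 1`, `v < 2^{yB}`:
   `t` is constant on the class `w mod 2^k` inside the intervals `[u 2^{k+yB}, (u+1) 2^{k+yB})`.
7. *Endgame for `Ω`* (`exists_odd_ne`, `endgame`; replaces the mean-value theorem): some odd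
   `β > 2^{k+1} u` has `t β ≠ t (β + 2^k)` — else `t` would be `2^k`-periodic on large odd numbers
   and a prime `p ≡ 1 (mod 2^k)` (`Nat.exists_prime_gt_modEq_one`) would give `t p = t (p²)`,
   `1 = 0`; for `y` large some `M ≥ 1` (an inverse of `β` mod `2^k` fixes the residue) puts both
   `β M` and `(β + 2^k) M` in the set of step 6, so `t β + t M ≡ t (β + 2^k) + t M (mod 2)`.

Steps 1–6 use only that `t` is `{0,1}`-valued; 4 and 7 use complete additivity mod 2; 7 uses
`t p = 1`.  The general statement is `CoonsCor17.not_isKAutomatic`.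

## References

* M. Coons, *(Non)Automaticity of number theoretic functions*, J. Théor. Nombres Bordeaux 22
  (2010), 339–352, Cor. 1.7 (read in the held arXiv text arXiv:0810.3709, p. 3). [Coons2011]
* J.-C. Schlage-Puchta, *Completely multiplicative automatic functions*, Integers 11 (2011), A31,
  731–738, Proposition 1 and its proof in §3 (held copy, pp. 2, 4–6). [Schlagepuchta2011]
-/

namespace Literature.Computability.Complexity

/-! ### The combinatorial core, for an abstract `{0,1}`-valued sequence -/

namespace CoonsCor17

variable {t : ℕ → ℕ} {κ : Type*} {σ : ℕ → κ} {R : ℕ → ℕ → Set κ}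

/-- `n ↦ t (2^l n + r)` lies in the `2`-kernel when `r < 2^l`. [folklore] -/
theorem shift_mem_kKernel (t : ℕ → ℕ) {l r : ℕ} (hr : r < 2 ^ l) :
    (fun n => t (2 ^ l * n + r)) ∈ kKernel 2 t :=
  ⟨l, r, hr, rfl⟩

/-- Carry-free concatenation bound: `2^l v + r < 2^(l+z)` for `r < 2^l`, `v < 2^z`. [folklore] -/
theorem two_pow_mul_add_lt {l r z v : ℕ} (hr : r < 2 ^ l) (hv : v < 2 ^ z) :
    2 ^ l * v + r < 2 ^ (l + z) := by
  rw [pow_add]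
  calc 2 ^ l * v + r < 2 ^ l * v + 2 ^ l := by omega
    _ = 2 ^ l * (v + 1) := by ring
    _ ≤ 2 ^ l * 2 ^ z := Nat.mul_le_mul_left _ hv

/-! Colouring `σ : ℕ → (K → Fin 2)` with `hσ : (σ m f).val = f m % 2` (Schlage-Puchta's `χ(n)`). -/

/-- Equal colours have equal futures (mod 2). [cite: Schlagepuchta2011, proof of Proposition 1] -/
theorem sig_apply_eq {σ : ℕ → ↥(kKernel 2 t) → Fin 2} (hσ : ∀ m f, (σ m f).val = f.1 m % 2)
    {m m' : ℕ} (h : σ m = σ m') {l r : ℕ} (hr : r < 2 ^ l) :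
    t (2 ^ l * m + r) % 2 = t (2 ^ l * m' + r) % 2 := by
  have := congrArg (fun g => (g ⟨_, shift_mem_kKernel t hr⟩).val) h
  simpa only [hσ] using this

/-- Equal colours have equal futures, for a `{0,1}`-valued sequence.
[cite: Schlagepuchta2011, proof of Proposition 1] -/
theorem futures (ht2 : ∀ n, t n < 2) {σ : ℕ → ↥(kKernel 2 t) → Fin 2}
    (hσ : ∀ m f, (σ m f).val = f.1 m % 2) {m m' : ℕ} (h : σ m = σ m') {l r : ℕ}
    (hr : r < 2 ^ l) : t (2 ^ l * m + r) = t (2 ^ l * m' + r) := by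
  have := sig_apply_eq hσ h hr
  rwa [Nat.mod_eq_of_lt (ht2 _), Nat.mod_eq_of_lt (ht2 _)] at this

/-- The colouring is a right congruence: appending the same `z` digits to equally coloured numbers
gives equally coloured numbers. [cite: Schlagepuchta2011, proof of Proposition 1] -/
theorem sig_append {σ : ℕ → ↥(kKernel 2 t) → Fin 2} (hσ : ∀ m f, (σ m f).val = f.1 m % 2)
    {n n' : ℕ} (h : σ n = σ n') {z v : ℕ} (hv : v < 2 ^ z) :
    σ (n * 2 ^ z + v) = σ (n' * 2 ^ z + v) := by
  funext f
  apply Fin.ext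
  rw [hσ, hσ]
  obtain ⟨g, l, r, hr, rfl⟩ := f
  have e : ∀ x, 2 ^ l * (x * 2 ^ z + v) + r = 2 ^ (l + z) * x + (2 ^ l * v + r) := by
    intro x; rw [pow_add]; ring
  show t (2 ^ l * (n * 2 ^ z + v) + r) % 2 = t (2 ^ l * (n' * 2 ^ z + v) + r) % 2
  rw [e, e]
  exact sig_apply_eq hσ h (two_pow_mul_add_lt hr hv)

/-! Reachable colour sets `R z n = {σ (n 2^z + v) : v < 2^z}` (states reachable from the state of
`n` in exactly `z` steps) for a right-congruence colouring `σ : ℕ → κ` (`happ`), given by `hR`. -/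

/-- Monotone shift: `R y m ⊆ R y' m → R (y+z) m ⊆ R (y'+z) m`.
[cite: Schlagepuchta2011, proof of Proposition 1] -/
theorem reach_add_subset
    (happ : ∀ n n', σ n = σ n' → ∀ z v, v < 2 ^ z → σ (n * 2 ^ z + v) = σ (n' * 2 ^ z + v))
    (hR : ∀ z n, R z n = {c | ∃ v < 2 ^ z, σ (n * 2 ^ z + v) = c})
    {m y y' : ℕ} (h : R y m ⊆ R y' m) (z : ℕ) : R (y + z) m ⊆ R (y' + z) m := by
  rw [hR, hR]
  rintro c ⟨x, hx, rfl⟩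
  have hz : 0 < 2 ^ z := by positivity
  have hv : x / 2 ^ z < 2 ^ y := by
    rw [Nat.div_lt_iff_lt_mul hz, ← pow_add]; exact hx
  have hv' : x % 2 ^ z < 2 ^ z := Nat.mod_lt _ hz
  have hmem : σ (m * 2 ^ y + x / 2 ^ z) ∈ R y m := by rw [hR]; exact ⟨_, hv, rfl⟩
  obtain ⟨w, hw, hw'⟩ : ∃ w < 2 ^ y', σ (m * 2 ^ y' + w) = σ (m * 2 ^ y + x / 2 ^ z) := by
    have := h hmem; rwa [hR] at this
  refine ⟨w * 2 ^ z + x % 2 ^ z, ?_, ?_⟩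
  · have := two_pow_mul_add_lt hv' hw
    rw [add_comm y' z]; linarith [mul_comm w (2 ^ z)]
  · have e1 : m * 2 ^ (y' + z) + (w * 2 ^ z + x % 2 ^ z)
        = (m * 2 ^ y' + w) * 2 ^ z + x % 2 ^ z := by rw [pow_add]; ring
    have e2 : m * 2 ^ (y + z) + x = (m * 2 ^ y + x / 2 ^ z) * 2 ^ z + x % 2 ^ z := by
      conv_lhs => rw [← Nat.div_add_mod x (2 ^ z)]
      rw [pow_add]; ring
    rw [e1, e2]
    exact happ _ _ hw' _ _ hv'

/-- Shift: `R y m = R y' m → R (y+z) m = R (y'+z) m`.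
[cite: Schlagepuchta2011, proof of Proposition 1] -/
theorem reach_add_eq
    (happ : ∀ n n', σ n = σ n' → ∀ z v, v < 2 ^ z → σ (n * 2 ^ z + v) = σ (n' * 2 ^ z + v))
    (hR : ∀ z n, R z n = {c | ∃ v < 2 ^ z, σ (n * 2 ^ z + v) = c})
    {m y y' : ℕ} (h : R y m = R y' m) (z : ℕ) : R (y + z) m = R (y' + z) m :=
  Set.Subset.antisymm (reach_add_subset happ hR (fun _ hc => h ▸ hc) z)
    (reach_add_subset happ hR (fun _ hc => h.symm ▸ hc) z)

/-- Uniform eventual periodicity of the reachable colour sets: for finitely many colours there is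
one `B ≥ 1` with `R (yB) m = R B m` for all `m` and all `y ≥ 1` (Schlage-Puchta: `B = |S|!`; here
`B = T!` with `T` the number of colour sets). [cite: Schlagepuchta2011, proof of Proposition 1] -/
theorem exists_period [Finite κ]
    (happ : ∀ n n', σ n = σ n' → ∀ z v, v < 2 ^ z → σ (n * 2 ^ z + v) = σ (n' * 2 ^ z + v))
    (hR : ∀ z n, R z n = {c | ∃ v < 2 ^ z, σ (n * 2 ^ z + v) = c}) :
    ∃ B, 1 ≤ B ∧ ∀ m y, 1 ≤ y → R (y * B) m = R B m := by
  classical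
  haveI : Fintype (Set κ) := Fintype.ofFinite _
  set T := Fintype.card (Set κ) with hT
  refine ⟨T.factorial, Nat.factorial_pos T, fun m y hy => ?_⟩
  obtain ⟨i, j, hij, he⟩ := Fintype.exists_ne_map_eq_of_card_lt
    (fun i : Fin (T + 1) => R i m) (by simp [hT])
  wlog hlt : i.val < j.val generalizing i j
  · exact this j i hij.symm he.symm (by omega)
  set p := j.val - i.val with hpdef
  have hp : 0 < p := by omega
  have hpT : p ≤ T := by omega
  have key : ∀ n z, R (i.val + z + n * p) m = R (i.val + z) m := by
    intro n
    induction n with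
    | zero => intro z; simp
    | succ n ih =>
      intro z
      have h1 : R (j.val + (z + n * p)) m = R (i.val + (z + n * p)) m :=
        reach_add_eq happ hR he.symm _
      calc R (i.val + z + (n + 1) * p) m = R (j.val + (z + n * p)) m := by
            congr 1; rw [hpdef, add_mul, one_mul]; omega
        _ = R (i.val + (z + n * p)) m := h1
        _ = R (i.val + z + n * p) m := by rw [add_assoc]
        _ = R (i.val + z) m := ih z
  obtain ⟨q, hq⟩ := Nat.dvd_factorial hp hpT
  have hiT : i.val ≤ T.factorial := le_trans (by omega) (Nat.self_le_factorial T)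
  obtain ⟨y', rfl⟩ : ∃ y', y = y' + 1 := ⟨y - 1, by omega⟩
  have e : (y' + 1) * T.factorial = i.val + (T.factorial - i.val) + (y' * q) * p := by
    have h2 : i.val + (T.factorial - i.val) = T.factorial := by omega
    calc (y' + 1) * T.factorial = T.factorial + y' * T.factorial := by ring
      _ = (i.val + (T.factorial - i.val)) + y' * (p * q) := by rw [h2, ← hq]
      _ = i.val + (T.factorial - i.val) + (y' * q) * p := by ring
  have e' : T.factorial = i.val + (T.factorial - i.val) := by omega
  rw [e, key, ← e']

/-- Step 4 (division by the common difference): from a `σ`-monochromatic progression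
`a, a+D, …, a+ND` one gets a `t`-constant progression with difference `2^D` and `N` terms, for a
completely additive (mod 2) `{0,1}`-valued `t`. [cite: Schlagepuchta2011, proof of Proposition 1] -/
theorem ap_of_mono (ht2 : ∀ n, t n < 2)
    (hmul : ∀ m n, 0 < m → 0 < n → t (m * n) = (t m + t n) % 2)
    {σ : ℕ → ↥(kKernel 2 t) → Fin 2} (hσ : ∀ m f, (σ m f).val = f.1 m % 2)
    {D a N : ℕ} (hD : 0 < D) (hmono : ∀ j ≤ N, σ (a + j * D) = σ a) :
    ∃ a1, ∀ j < N, t (a1 + j * 2 ^ D) = t a1 := by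
  have hPD : D < 2 ^ D := Nat.lt_two_pow_self
  -- `b < D` with `D ∣ a 2^D + b`
  obtain ⟨b, hbD, hdvd⟩ : ∃ b, b < D ∧ D ∣ a * 2 ^ D + b := by
    refine ⟨(D - 1) * (a * 2 ^ D) % D, Nat.mod_lt _ hD, ?_⟩
    rw [Nat.dvd_iff_mod_eq_zero, Nat.add_mod_mod]
    obtain ⟨D', rfl⟩ : ∃ D', D = D' + 1 := ⟨D - 1, by omega⟩
    have : a * 2 ^ (D' + 1) + (D' + 1 - 1) * (a * 2 ^ (D' + 1))
        = (D' + 1) * (a * 2 ^ (D' + 1)) := by rw [Nat.add_sub_cancel]; ring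
    rw [this, Nat.mul_mod_right]
  set x : ℕ → ℕ := fun j => (a * 2 ^ D + b) / D + j * 2 ^ D with hx
  have hDx : ∀ j, D * x j = 2 ^ D * (a + j * D) + b := by
    intro j
    simp only [hx, mul_add, Nat.mul_div_cancel' hdvd]
    ring
  -- all `t (D * x j)`, `j ≤ N`, coincide
  have hconst : ∀ j ≤ N, t (D * x j) = t (D * x 0) := by
    intro j hj
    rw [hDx, hDx]
    have h1 := futures ht2 hσ (hmono j hj) (lt_trans hbD hPD)
    have h0 := futures ht2 hσ (hmono 0 (Nat.zero_le _)) (lt_trans hbD hPD)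
    rw [h1, ← h0]
  have hxpos : ∀ j, 1 ≤ j → 0 < x j := by
    intro j hj
    have h3 : 1 * 2 ^ D ≤ j * 2 ^ D := Nat.mul_le_mul_right _ hj
    have h4 : 0 < 2 ^ D := by positivity
    exact Nat.add_pos_right _ (by omega)
  refine ⟨x 1, fun j hj => ?_⟩
  have e : x 1 + j * 2 ^ D = x (j + 1) := by simp only [hx]; ring
  rw [e]
  have h1 := hconst (j + 1) (by omega)
  have h2 := hconst 1 (by omega)
  rw [hmul _ _ hD (hxpos _ (by omega))] at h1 h2
  have := ht2 (x (j + 1))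
  have := ht2 (x 1)
  have := ht2 D
  omega

/-- Step 5 (alignment): a `t`-constant progression with difference `2^k` and `2^(B+1)+1` terms
contains a full aligned block `{2^k (u 2^B + v) + w : v < 2^B}`.
[cite: Schlagepuchta2011, proof of Proposition 1] -/
theorem align {a1 N k B : ℕ} (hN : 2 ^ (B + 1) + 1 ≤ N)
    (h : ∀ j < N, t (a1 + j * 2 ^ k) = t a1) :
    ∃ u w, w < 2 ^ k ∧ ∀ v < 2 ^ B, t (2 ^ k * (u * 2 ^ B + v) + w) = t a1 := by
  have hk : 0 < 2 ^ k := by positivity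
  have hB : 0 < 2 ^ B := by positivity
  set q := a1 / 2 ^ k with hq
  refine ⟨q / 2 ^ B + 1, a1 % 2 ^ k, Nat.mod_lt _ hk, fun v hv => ?_⟩
  have hqU : q ≤ (q / 2 ^ B + 1) * 2 ^ B := by
    have := Nat.lt_div_mul_add (a := q) hB
    rw [add_mul, one_mul]; omega
  obtain ⟨d, hd⟩ : ∃ d, (q / 2 ^ B + 1) * 2 ^ B + v = q + d :=
    ⟨_, (Nat.add_sub_cancel' (by omega)).symm⟩
  have hdN : d < N := by
    have h1 : q / 2 ^ B * 2 ^ B ≤ q := Nat.div_mul_le_self q (2 ^ B)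
    have h2 : 2 ^ (B + 1) = 2 ^ B + 2 ^ B := by rw [pow_succ]; ring
    rw [add_mul, one_mul] at hd
    omega
  have := h d hdN
  rw [hd, ← this]
  congr 1
  have ha : 2 ^ k * q + a1 % 2 ^ k = a1 := Nat.div_add_mod a1 (2 ^ k)
  calc 2 ^ k * (q + d) + a1 % 2 ^ k = (2 ^ k * q + a1 % 2 ^ k) + d * 2 ^ k := by ring
    _ = a1 + d * 2 ^ k := by rw [ha]

/-- Step 6 (pumping): a `t`-constant aligned block at depth `B` propagates to all depths `yB`.
[cite: Schlagepuchta2011, proof of Proposition 1] -/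
theorem pump (ht2 : ∀ n, t n < 2) {σ : ℕ → ↥(kKernel 2 t) → Fin 2}
    (hσ : ∀ m f, (σ m f).val = f.1 m % 2) {R : ℕ → ℕ → Set (↥(kKernel 2 t) → Fin 2)}
    (hR : ∀ z n, R z n = {c | ∃ v < 2 ^ z, σ (n * 2 ^ z + v) = c})
    {k u w c B : ℕ} (hw : w < 2 ^ k) (hB : ∀ y, 1 ≤ y → R (y * B) u = R B u)
    (h : ∀ v < 2 ^ B, t (2 ^ k * (u * 2 ^ B + v) + w) = c) :
    ∀ y, 1 ≤ y → ∀ v < 2 ^ (y * B), t (2 ^ k * (u * 2 ^ (y * B) + v) + w) = c := by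
  intro y hy v hv
  have hmem : σ (u * 2 ^ (y * B) + v) ∈ R (y * B) u := by rw [hR]; exact ⟨v, hv, rfl⟩
  rw [hB y hy, hR] at hmem
  obtain ⟨v', hv', he⟩ := hmem
  rw [← h v' hv']
  exact futures ht2 hσ he.symm hw

/-- Step 7a (non-periodicity, special to `Ω`): for a completely additive (mod 2) `t` with
`t p = 1` at every prime, `t` is not eventually `2^k`-periodic along the odd numbers (`k ≥ 1`): a
prime `p ≡ 1 (mod 2^k)` would give `t p = t (p²)`. [folklore] -/
theorem exists_odd_ne (hmul : ∀ m n, 0 < m → 0 < n → t (m * n) = (t m + t n) % 2)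
    (hprime : ∀ p, p.Prime → t p = 1) {k : ℕ} (hk : 1 ≤ k) (β0 : ℕ) :
    ∃ β, β0 < β ∧ Odd β ∧ t β ≠ t (β + 2 ^ k) := by
  by_contra! H
  obtain ⟨p, hp, hgt, hmod⟩ :=
    Nat.exists_prime_gt_modEq_one (max β0 2) (k := 2 ^ k) (by positivity)
  have hp2 : 2 < p := lt_of_le_of_lt (le_max_right _ _) hgt
  have hβ0 : β0 < p := lt_of_le_of_lt (le_max_left _ _) hgt
  have hodd : Odd p := hp.odd_of_ne_two (by omega)
  have h2k : Even (2 ^ k) := Nat.even_pow.mpr ⟨even_two, by omega⟩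
  have chain : ∀ i, t (p + i * 2 ^ k) = t p := by
    intro i
    induction i with
    | zero => simp
    | succ i ih =>
      have hoi : Odd (p + i * 2 ^ k) := hodd.add_even (h2k.mul_left i)
      have := H (p + i * 2 ^ k) (by omega) hoi
      calc t (p + (i + 1) * 2 ^ k) = t (p + i * 2 ^ k + 2 ^ k) := by ring_nf
        _ = t (p + i * 2 ^ k) := this.symm
        _ = t p := ih
  have hdvd : 2 ^ k ∣ p - 1 := (Nat.modEq_iff_dvd' (by omega : 1 ≤ p)).mp hmod.symm
  obtain ⟨i, hi⟩ := hdvd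
  have hsq : p + (p * i) * 2 ^ k = p * p := by
    have h1 : (p - 1) + 1 = p := by omega
    calc p + (p * i) * 2 ^ k = p * (2 ^ k * i) + p := by ring
      _ = p * (p - 1) + p := by rw [hi]
      _ = p * ((p - 1) + 1) := by ring
      _ = p * p := by rw [h1]
  have h1 := chain (p * i)
  rw [hsq, hmul p p (by omega) (by omega), hprime p hp] at h1
  omega

/-- Step 7b (endgame, special to `Ω`): `t` cannot be constant on a residue class `w mod 2^k`
(`k ≥ 1`) inside the aligned intervals `[u 2^(k+yB), (u+1) 2^(k+yB))` for all `y ≥ 1`.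
[folklore] -/
theorem endgame (ht2 : ∀ n, t n < 2)
    (hmul : ∀ m n, 0 < m → 0 < n → t (m * n) = (t m + t n) % 2)
    (hprime : ∀ p, p.Prime → t p = 1) {k u w c B : ℕ} (hk : 1 ≤ k) (hB1 : 1 ≤ B)
    (hw : w < 2 ^ k)
    (h : ∀ y, 1 ≤ y → ∀ v < 2 ^ (y * B), t (2 ^ k * (u * 2 ^ (y * B) + v) + w) = c) :
    False := by
  set P := 2 ^ k with hP
  have hP0 : 0 < P := by positivity
  obtain ⟨β, hβgt, hβodd, hβne⟩ := exists_odd_ne hmul hprime hk (2 * P * u)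
  rw [← hP] at hβne
  have hβ0 : 0 < β := by omega
  set y := 2 * (β + P) + 1 with hy
  set L := 2 ^ (y * B) with hL
  have hyL : y < L :=
    calc y < 2 ^ y := Nat.lt_two_pow_self
      _ ≤ 2 ^ (y * B) := Nat.pow_le_pow_right two_pos (Nat.le_mul_of_pos_right _ hB1)
  set X := P * u * L with hX
  -- every `n ≡ w (mod P)` in `[X, X + P L)` has `t n = c`
  have key : ∀ n, X ≤ n → n < X + P * L → n % P = w → t n = c := by
    intro n hXn hnlt hnw
    have h1 : u * L ≤ n / P := by
      rw [Nat.le_div_iff_mul_le hP0]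
      calc u * L * P = P * u * L := by ring
        _ ≤ n := hXn
    have h2 : n / P < u * L + L := by
      rw [Nat.div_lt_iff_lt_mul hP0]
      calc n < X + P * L := hnlt
        _ = (u * L + L) * P := by rw [hX]; ring
    obtain ⟨v, hv⟩ : ∃ v, n / P = u * L + v := ⟨_, (Nat.add_sub_cancel' h1).symm⟩
    have hvL : v < L := by omega
    have := h y (by omega) v hvL
    rw [← hL, ← hv, ← hnw, Nat.div_add_mod n P] at this
    exact this
  -- choose `M` with `X < β M`, `(β + P) M < X + P L`, `β M ≡ w (mod P)`
  obtain ⟨M, hM0, hMle, hMw⟩ : ∃ M, X / β + 1 ≤ M ∧ M ≤ X / β + P ∧ β * M % P = w := by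
    haveI : NeZero P := ⟨hP0.ne'⟩
    have hcop : Nat.Coprime β P := Nat.Coprime.pow_right k (Nat.coprime_two_right.mpr hβodd)
    have hinv : (β : ZMod P) * (β : ZMod P)⁻¹ = 1 := ZMod.coe_mul_inv_eq_one β hcop
    set m0 : ℕ := X / β + 1 with hm0
    set z : ZMod P := ((w : ZMod P) - (β : ZMod P) * (m0 : ZMod P)) * (β : ZMod P)⁻¹ with hz
    refine ⟨m0 + z.val, by omega, by have := z.val_lt; omega, ?_⟩
    have hw' : w % P = w := Nat.mod_eq_of_lt hw
    rw [← hw', ← ZMod.natCast_eq_natCast_iff']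
    push_cast
    rw [ZMod.natCast_zmod_val, hz]
    linear_combination ((w : ZMod P) - (β : ZMod P) * (m0 : ZMod P)) * hinv
  have hM1 : 0 < M := lt_of_lt_of_le (Nat.succ_pos _) hM0
  have hXn : X ≤ β * M := by
    have := Nat.lt_mul_div_succ X hβ0
    nlinarith [Nat.mul_le_mul_left β hM0]
  have h2X : 2 * (X / β) ≤ L := by
    refine le_trans (Nat.mul_div_le_mul_div_assoc 2 X β) (Nat.div_le_of_le_mul ?_)
    calc 2 * X = (2 * P * u) * L := by rw [hX]; ring
      _ ≤ β * L := Nat.mul_le_mul_right _ hβgt.le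
  have hsum : X / β + (β + P) < L := by omega
  have hn' : (β + P) * M < X + P * L :=
    calc (β + P) * M ≤ (β + P) * (X / β + P) := Nat.mul_le_mul_left _ hMle
      _ = β * (X / β) + P * (X / β + (β + P)) := by ring
      _ ≤ X + P * (X / β + (β + P)) := by gcongr; exact Nat.mul_div_le X β
      _ < X + P * L := Nat.add_lt_add_left (mul_lt_mul_of_pos_left hsum hP0) _
  have htn : t (β * M) = c :=
    key _ hXn (lt_of_le_of_lt (Nat.mul_le_mul_right _ (Nat.le_add_right β P)) hn') hMw
  have htn' : t ((β + P) * M) = c := by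
    refine key _ (le_trans hXn (Nat.mul_le_mul_right _ (Nat.le_add_right β P))) hn' ?_
    rw [add_mul, Nat.add_mul_mod_self_left, hMw]
  rw [hmul _ _ hβ0 hM1] at htn
  rw [hmul _ _ (by omega) hM1] at htn'
  have := ht2 β
  have := ht2 (β + P)
  have := ht2 M
  exact hβne (by omega)

/-- **No completely additive (mod 2) `{0,1}`-valued sequence with value `1` at every prime is
`2`-automatic** — the abstract form of Coons's Corollary 1.7, proved by Schlage-Puchta's
van der Waerden / pumping argument with an elementary endgame.
[cite: Schlagepuchta2011, Proposition 1 (proof)] -/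
theorem not_isKAutomatic (ht2 : ∀ n, t n < 2)
    (hmul : ∀ m n, 0 < m → 0 < n → t (m * n) = (t m + t n) % 2)
    (hprime : ∀ p, p.Prime → t p = 1) : ¬ IsKAutomatic 2 t := by
  intro hK
  classical
  haveI : Finite ↥(kKernel 2 t) := hK.to_subtype
  -- the colouring `σ m = (f m mod 2)_{f ∈ K}` and its reachable colour sets `R z n`
  set σ : ℕ → ↥(kKernel 2 t) → Fin 2 := fun m f => ⟨f.1 m % 2, Nat.mod_lt _ two_pos⟩
  have hσ : ∀ m f, (σ m f).val = f.1 m % 2 := fun _ _ => rfl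
  have happ : ∀ n n', σ n = σ n' → ∀ z v, v < 2 ^ z → σ (n * 2 ^ z + v) = σ (n' * 2 ^ z + v) :=
    fun n n' h z v hv => sig_append hσ h hv
  set R : ℕ → ℕ → Set (↥(kKernel 2 t) → Fin 2) :=
    fun z n => {c | ∃ v < 2 ^ z, σ (n * 2 ^ z + v) = c}
  have hR : ∀ z n, R z n = {c | ∃ v < 2 ^ z, σ (n * 2 ^ z + v) = c} := fun _ _ => rfl
  obtain ⟨B, hB1, hper⟩ := exists_period happ hR
  set N := 2 ^ (B + 1) + 1
  obtain ⟨D, hD, a, c0, hmono⟩ :=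
    Combinatorics.exists_mono_homothetic_copy (Finset.range (N + 1)) σ
  have hmono' : ∀ j ≤ N, σ (a + j * D) = σ a := by
    intro j hj
    have h1 := hmono j (Finset.mem_range.mpr (by omega))
    have h0 := hmono 0 (Finset.mem_range.mpr (by omega))
    simp only [smul_eq_mul, mul_zero, zero_add] at h1 h0
    rw [show a + j * D = D * j + a by ring, h1, h0]
  obtain ⟨a1, ha1⟩ := ap_of_mono ht2 hmul hσ hD hmono'
  obtain ⟨u, w, hw, hal⟩ := align (k := D) (B := B) (le_refl N) ha1
  have hpump := pump ht2 hσ hR hw (hper u) hal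
  exact endgame ht2 hmul hprime (Nat.one_le_iff_ne_zero.mpr hD.ne') hB1 hw hpump

end CoonsCor17

/-! ### The discharge -/

open ArithmeticFunction in
/-- **Discharge of `coons_cardFactors_mod_two_not_automatic` (Coons 2010, Corollary 1.7):** "The
function `(Ω(n) mod 2)` is not `2`–automatic", i.e. the `2`-kernel of `n ↦ Ω n % 2`
(`Ω = ArithmeticFunction.cardFactors`) is infinite.  Coons derives it (via his Lemma 1.6 and
`Ω(n) mod 2 = (1 - λ(n))/2`) from Theorem 1.5, whose printed proof counts poles of `ζ(2s)/ζ(s)`;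
the proof given here is the elementary one of `CoonsCor17.not_isKAutomatic` (Schlage-Puchta's
van der Waerden/pumping argument, Integers 11 (2011) A31, proof of Prop. 1, with an elementary
endgame using a prime `p ≡ 1 (mod 2^k)`), applied with `t n = Ω n % 2`: `t` is `{0,1}`-valued,
completely additive mod 2 (`cardFactors_mul`) and `t p = 1` (`cardFactors_apply_prime`).
[cite: Coons2011, Corollary 1.7] -/
theorem coons_cardFactors_mod_two_not_automatic_holds :
    coons_cardFactors_mod_two_not_automatic := by
  unfold coons_cardFactors_mod_two_not_automatic
  refine CoonsCor17.not_isKAutomatic (t := fun n => cardFactors n % 2) ?_ ?_ ?_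
  · intro n; exact Nat.mod_lt _ two_pos
  · intro m n hm hn
    show cardFactors (m * n) % 2 = (cardFactors m % 2 + cardFactors n % 2) % 2
    rw [cardFactors_mul (by omega) (by omega), Nat.add_mod]
  · intro p hp
    show cardFactors p % 2 = 1
    rw [cardFactors_apply_prime hp]

end Literature.Computability.Complexity
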